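import Mathlib
import HarnessLib
import Summits.AtomisticToContinuum.Crystallization.Theorems.PricedLinkCensusSoftLayerPropagationOneStackingMapSearchDefs
import Summits.AtomisticToContinuum.Crystallization.Theorems.PricedLinkCensusSoftLayerPropagationOneStackingMapSearchBasic

/-!
# One-stacking map engine: abstract exact developments and realized search states

Route `PricedLinkCensus`, crux `SoftLayerPropagation` (stmt-AtomisticToContinuum-14233), line
`Sketch`, stub `stub_oneStackingMap`.  `Dev` packages what the search uses of an exact
development in the shadow frame of the centre (scale `nn² = 2`): exact stars on the graph
`4`-ball (a real linear isometric image of the FCC / HCP model, both inclusions), the root star a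
model itself, star injectivity, exactly twelve bonds on the `5`-ball, and bonds among neighbours =
unit shadow distances.  `RealizedBy A s emb` (a structure of proofs) says that the search state `s` describes a
part of `A` through the injection `emb` of its sites.  Lemmas: preservation of `RealizedBy` under
recording a true bond and under appending a true new neighbour, and SATURATION (twelve recorded
bonds are all the bonds).  All [folklore].
-/

noncomputable section

namespace Summit.AtomisticToContinuum.Crystallization.Theorems

namespace OneStacking

open V3

/-- **An exact development, as used by the search** (shadow frame of the centre, `nn² = 2`).
[folklore] -/
structure Dev where
  /-- number of sites -/
  N : ℕ
  /-- the bond graph -/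
  G : SimpleGraph (Fin N)
  /-- the centre -/
  i : Fin N
  /-- shadow positions -/
  pos : Fin N → E3
  /-- the centre is at the origin -/
  pos_i : pos i = 0
  /-- exact stars on the graph `4`-ball -/
  star : ∀ j, (∃ w : G.Walk i j, w.length ≤ 4) → ∃ (P0 : List V3) (Q : E3 →ₗᵢ[ℝ] E3),
    (P0 = FCC ∨ P0 = HCP) ∧ (∀ k, G.Adj j k → ∃ p ∈ P0, pos k = pos j + Q (toE3 p)) ∧
      (∀ p ∈ P0, ∃ k, G.Adj j k ∧ pos k = pos j + Q (toE3 p))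
  /-- the root star is a model -/
  root_star : ∃ P0 : List V3, (P0 = FCC ∨ P0 = HCP) ∧ (∀ k, G.Adj i k → ∃ p ∈ P0, pos k = toE3 p) ∧
    (∀ p ∈ P0, ∃ k, G.Adj i k ∧ pos k = toE3 p)
  /-- stars are injective -/
  star_inj : ∀ j, (∃ w : G.Walk i j, w.length ≤ 4) → ∀ k k', G.Adj j k → G.Adj j k' → pos k = pos k' → k = k'
  /-- exactly twelve bonds on the `5`-ball -/
  twelve : ∀ j, (∃ w : G.Walk i j, w.length ≤ 5) → ∃ l : List (Fin N), l.Nodup ∧ l.length = 12 ∧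
    ∀ k, G.Adj j k ↔ k ∈ l
  /-- bonds among the neighbours of a `4`-ball site are the unit shadow distances -/
  adj_iff : ∀ j, (∃ w : G.Walk i j, w.length ≤ 4) → ∀ k k', G.Adj j k → G.Adj j k' →
    (G.Adj k k' ↔ ‖pos k - pos k'‖ ^ 2 = 2)

/-- Graph balls about the centre are monotone in the radius. [folklore] -/
theorem Dev.ball_mono (A : Dev) {t t' : ℕ} (h : t ≤ t') {j : Fin A.N} (hj : ∃ w : A.G.Walk A.i j, w.length ≤ t) :
    ∃ w : A.G.Walk A.i j, w.length ≤ t' := by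
  obtain ⟨w, hw⟩ := hj; exact ⟨w, hw.trans h⟩

/-- A neighbour of a ball site is in the next ball. [folklore] -/
theorem Dev.ball_adj (A : Dev) {t : ℕ} {j k : Fin A.N} (hj : ∃ w : A.G.Walk A.i j, w.length ≤ t) (h : A.G.Adj j k) :
    ∃ w : A.G.Walk A.i k, w.length ≤ t + 1 := by
  obtain ⟨w, hw⟩ := hj
  exact ⟨w.concat h, by rw [SimpleGraph.Walk.length_concat]; omega⟩

/-- **A search state realized by a development** through the site map `emb` (a structure of
proofs, in `Type`). [folklore] -/
structure RealizedBy (A : Dev) (s : St) (emb : ℕ → Fin A.N) : Type where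
  /-- there is a site -/
  size_pos : 0 < s.size
  /-- the cursor is in range -/
  cur_le : s.cur ≤ s.size
  /-- the first site is the centre -/
  emb_zero : emb 0 = A.i
  /-- `emb` is injective on the sites -/
  inj : ∀ a b, a < s.size → b < s.size → emb a = emb b → a = b
  /-- positions are the shadow positions -/
  posE : ∀ a, a < s.size → A.pos (emb a) = toE3 (s.pos a)
  /-- levels bound the graph distance -/
  lvlE : ∀ a, a < s.size → ∃ w : A.G.Walk A.i (emb a), w.length ≤ s.lvl a
  /-- levels are at most `5` -/
  lvl5 : ∀ a, a < s.size → s.lvl a ≤ 5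
  /-- expanded sites have level at most `4` -/
  lvl4 : ∀ a, a < s.cur → s.lvl a ≤ 4
  /-- recorded bonds are bonds between sites -/
  nbrE : ∀ a, a < s.size → ∀ b ∈ s.nbrs a, b < s.size ∧ A.G.Adj (emb a) (emb b)
  /-- expanded sites have all their bonds recorded -/
  doneE : ∀ a, a < s.cur → ∀ k, A.G.Adj (emb a) k → ∃ b ∈ s.nbrs a, emb b = k
  /-- recorded bonds are symmetric -/
  symm : ∀ a, a < s.size → ∀ b ∈ s.nbrs a, a ∈ s.nbrs b
  /-- no bond is recorded twice -/
  nodup : ∀ a, a < s.size → (s.nbrs a).Nodup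

namespace RealizedBy

variable {A : Dev} {s : St} {emb : ℕ → Fin A.N}

/-- Beyond the array the recorded neighbours are empty. [folklore] -/
theorem nbrs_of_ge (s : St) {a : ℕ} (ha : s.size ≤ a) : s.nbrs a = [] := by
  rw [St.nbrs, St.site_eq, Array.getElem?_eq_none (by exact ha)]; rfl

/-- A recorded bond realizes as a bond. [folklore] -/
theorem adj (h : RealizedBy A s emb) {a b : ℕ} (hb : b ∈ s.nbrs a) : a < s.size ∧ b < s.size ∧ A.G.Adj (emb a) (emb b) := by
  by_cases ha : a < s.size
  · exact ⟨ha, (h.nbrE a ha b hb)⟩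
  · rw [nbrs_of_ge s (not_lt.1 ha)] at hb; cases hb

/-- **Saturation**: a `5`-ball site with twelve recorded bonds has all its bonds recorded.
[folklore] -/
theorem saturated (h : RealizedBy A s emb) {a : ℕ} (ha : a < s.size) (hlen : 12 ≤ (s.nbrs a).length)
    {k : Fin A.N} (hk : A.G.Adj (emb a) k) : ∃ b ∈ s.nbrs a, emb b = k := by
  obtain ⟨l, hl, hlen12, hiff⟩ := A.twelve (emb a) (A.ball_mono (h.lvl5 a ha) (h.lvlE a ha))
  -- the image of the recorded list is a nodup sublist of `l` of length ≥ 12, hence all of `l`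
  set m := (s.nbrs a).map emb with hm
  have hmnd : m.Nodup := by
    refine (h.nodup a ha).map_on fun b hb c hc hbc => h.inj b c (h.adj hb).2.1 (h.adj hc).2.1 hbc
  have hsub : m ⊆ l := fun y hy => by
    obtain ⟨b, hb, rfl⟩ := List.mem_map.1 hy
    exact (hiff _).1 (h.adj hb).2.2
  have hperm : m.Perm l := by
    refine (List.subperm_of_subset hmnd hsub).perm_of_length_le ?_
    rw [hlen12, hm, List.length_map]; exact hlen
  have hkl : k ∈ m := hperm.mem_iff.2 ((hiff k).1 hk)
  obtain ⟨b, hb, rfl⟩ := List.mem_map.1 hkl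
  exact ⟨b, hb, rfl⟩

/-- At most twelve bonds are recorded at a site. [folklore] -/
theorem length_le (h : RealizedBy A s emb) {a : ℕ} (ha : a < s.size) : (s.nbrs a).length ≤ 12 := by
  obtain ⟨l, hl, hlen12, hiff⟩ := A.twelve (emb a) (A.ball_mono (h.lvl5 a ha) (h.lvlE a ha))
  have hmnd : ((s.nbrs a).map emb).Nodup :=
    (h.nodup a ha).map_on fun b hb c hc hbc => h.inj b c (h.adj hb).2.1 (h.adj hc).2.1 hbc
  have hsub : (s.nbrs a).map emb ⊆ l := fun y hy => by
    obtain ⟨b, hb, rfl⟩ := List.mem_map.1 hy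
    exact (hiff _).1 (h.adj hb).2.2
  have := (List.subperm_of_subset hmnd hsub).length_le
  rw [List.length_map, hlen12] at this
  exact this

/-- **Recording a true bond** between two distinct unexpanded-or-fresh-listed sites preserves
realization. [folklore] -/
def link (h : RealizedBy A s emb) {a b : ℕ} (ha : a < s.size) (hb : b < s.size)
    (hadj : A.G.Adj (emb a) (emb b)) (hab : b ∉ s.nbrs a) (hba : a ∉ s.nbrs b)
    (hca : s.cur ≤ a) (hcb : s.cur ≤ b) : RealizedBy A (s.link a b) emb where
  size_pos := by rw [St.size_link]; exact h.size_pos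
  cur_le := by rw [St.size_link, St.cur_link]; exact h.cur_le
  emb_zero := h.emb_zero
  inj := by intro c d hc hd; rw [St.size_link] at hc hd; exact h.inj c d hc hd
  posE := by intro c hc; rw [St.size_link] at hc; rw [St.pos_link]; exact h.posE c hc
  lvlE := by intro c hc; rw [St.size_link] at hc; rw [St.lvl_link]; exact h.lvlE c hc
  lvl5 := by intro c hc; rw [St.size_link] at hc; rw [St.lvl_link]; exact h.lvl5 c hc
  lvl4 := by intro c hc; rw [St.cur_link] at hc; rw [St.lvl_link]; exact h.lvl4 c hc
  nbrE := by
    intro c hc d hd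
    rw [St.size_link] at hc ⊢
    rw [St.mem_nbrs_link s ha hb] at hd
    rcases hd with hd | ⟨rfl, rfl⟩ | ⟨rfl, rfl⟩
    · exact h.nbrE c hc d hd
    · exact ⟨hb, hadj⟩
    · exact ⟨ha, hadj.symm⟩
  doneE := by
    intro c hc k hk
    rw [St.cur_link] at hc
    obtain ⟨d, hd, rfl⟩ := h.doneE c hc k hk
    exact ⟨d, (St.mem_nbrs_link s ha hb c d).2 (Or.inl hd), rfl⟩
  symm := by
    intro c hc d hd
    rw [St.size_link] at hc
    rw [St.mem_nbrs_link s ha hb] at hd ⊢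
    rcases hd with hd | ⟨rfl, rfl⟩ | ⟨rfl, rfl⟩
    · exact Or.inl (h.symm c hc d hd)
    · exact Or.inr (Or.inr ⟨rfl, rfl⟩)
    · exact Or.inr (Or.inl ⟨rfl, rfl⟩)
  nodup := by
    intro c hc
    rw [St.size_link] at hc
    rw [St.nbrs_link s ha hb]
    by_cases hca' : c = a <;> by_cases hcb' : c = b
    · subst hca'; subst hcb'; exact absurd rfl hadj.ne
    · subst hca'; simp only [if_true, if_neg hcb', List.append_nil]
      exact List.nodup_append.2 ⟨h.nodup c hc, List.nodup_singleton _,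
        fun x hx y hy => by rw [List.mem_singleton] at hy; subst hy; rintro rfl; exact hab hx⟩
    · subst hcb'; simp only [if_neg hca', if_true, List.append_nil]
      exact List.nodup_append.2 ⟨h.nodup c hc, List.nodup_singleton _,
        fun x hx y hy => by rw [List.mem_singleton] at hy; subst hy; rintro rfl; exact hba hx⟩
    · simp only [if_neg hca', if_neg hcb', List.append_nil]; exact h.nodup c hc

/-- **Appending a true new neighbour**: a bond `emb a — y` to a site `y` not yet represented,
one level up from `a` (a site of level `≤ 4`), preserves realization with `emb` extended by
`size ↦ y`. [folklore] -/
def pushLink (h : RealizedBy A s emb) {a : ℕ} (ha : a < s.size) (hca : s.cur ≤ a) (hl : s.lvl a ≤ 4)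
    {y : Fin A.N} (hadj : A.G.Adj (emb a) y) (hnew : ∀ c, c < s.size → emb c ≠ y) {p : V3}
    (hp : A.pos y = toE3 p) :
    RealizedBy A ((s.push p (s.lvl a + 1)).link a s.size) (fun c => if c = s.size then y else emb c) := by
  have hsz : (s.push p (s.lvl a + 1)).size = s.size + 1 := St.size_push s _ _
  have ha' : a < (s.push p (s.lvl a + 1)).size := by rw [hsz]; omega
  have hs' : s.size < (s.push p (s.lvl a + 1)).size := by rw [hsz]; omega
  have hane : a ≠ s.size := Nat.ne_of_lt ha
  have hnb : s.nbrs s.size = [] := nbrs_of_ge s le_rfl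
  refine ⟨?_, ?_, ?_, ?_, ?_, ?_, ?_, ?_, ?_, ?_, ?_, ?_⟩
  · rw [St.size_link, hsz]; omega
  · rw [St.size_link, St.cur_link, St.cur_push, hsz]; exact h.cur_le.trans (Nat.le_succ _)
  · have : (0 : ℕ) ≠ s.size := Nat.ne_of_lt h.size_pos
    simp [this, h.emb_zero]
  · intro c d hc hd hcd
    rw [St.size_link, hsz] at hc hd
    by_cases hcs : c = s.size <;> by_cases hds : d = s.size
    · rw [hcs, hds]
    · simp only [hcs, if_true, hds, if_false] at hcd; exact absurd hcd.symm (hnew d (by omega))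
    · simp only [hcs, if_false, hds, if_true] at hcd; exact absurd hcd (hnew c (by omega))
    · simp only [hcs, hds, if_false] at hcd; exact h.inj c d (by omega) (by omega) hcd
  · intro c hc
    rw [St.size_link, hsz] at hc
    rw [St.pos_link, St.pos_push]
    by_cases hcs : c = s.size
    · subst hcs; simp [hp]
    · have hc' : c < s.size := by omega
      simp [hcs, hc', h.posE c hc']
  · intro c hc
    rw [St.size_link, hsz] at hc
    rw [St.lvl_link, St.lvl_push]
    by_cases hcs : c = s.size
    · subst hcs; rw [if_pos rfl, if_neg (lt_irrefl _), if_pos rfl]; exact A.ball_adj (h.lvlE a ha) hadj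
    · have hc' : c < s.size := by omega
      rw [if_neg hcs, if_pos hc']; exact h.lvlE c hc'
  · intro c hc
    rw [St.size_link, hsz] at hc
    rw [St.lvl_link, St.lvl_push]
    by_cases hcs : c = s.size
    · subst hcs; simp only [lt_irrefl, if_false, if_true]; omega
    · have hc' : c < s.size := by omega
      simp only [hc', if_true]; exact h.lvl5 c hc'
  · intro c hc
    rw [St.cur_link, St.cur_push] at hc
    have hc' : c < s.size := lt_of_lt_of_le hc h.cur_le
    rw [St.lvl_link, St.lvl_push, if_pos hc']
    exact h.lvl4 c hc
  · intro c hc d hd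
    rw [St.size_link, hsz] at hc ⊢
    rw [St.mem_nbrs_link _ ha' hs', St.nbrs_push] at hd
    rcases hd with hd | ⟨rfl, rfl⟩ | ⟨rfl, rfl⟩
    · split_ifs at hd with hc'
      · obtain ⟨hd1, hd2⟩ := h.nbrE c hc' d hd
        have hds : d ≠ s.size := Nat.ne_of_lt hd1
        have hcs : c ≠ s.size := Nat.ne_of_lt hc'
        simp only [hds, hcs, if_false]; exact ⟨by omega, hd2⟩
      · cases hd
    · simp only [hane, if_false, if_true]; exact ⟨by omega, hadj⟩
    · simp only [hane, if_false, if_true]; exact ⟨by omega, hadj.symm⟩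
  · intro c hc k hk
    rw [St.cur_link, St.cur_push] at hc
    have hc' : c < s.size := lt_of_lt_of_le hc h.cur_le
    have hcs : c ≠ s.size := Nat.ne_of_lt hc'
    simp only [hcs, if_false] at hk
    obtain ⟨d, hd, rfl⟩ := h.doneE c hc k hk
    have hds : d ≠ s.size := Nat.ne_of_lt (h.nbrE c hc' d hd).1
    refine ⟨d, ?_, by simp [hds]⟩
    rw [St.mem_nbrs_link _ ha' hs', St.nbrs_push, if_pos hc']
    exact Or.inl hd
  · intro c hc d hd
    rw [St.size_link, hsz] at hc
    rw [St.mem_nbrs_link _ ha' hs', St.nbrs_push] at hd ⊢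
    rcases hd with hd | ⟨rfl, rfl⟩ | ⟨rfl, rfl⟩
    · split_ifs at hd with hc'
      · have hd1 := (h.nbrE c hc' d hd).1
        rw [if_pos hd1]; exact Or.inl (h.symm c hc' d hd)
      · cases hd
    · exact Or.inr (Or.inr ⟨rfl, rfl⟩)
    · exact Or.inr (Or.inl ⟨rfl, rfl⟩)
  · intro c hc
    rw [St.size_link, hsz] at hc
    rw [St.nbrs_link _ ha' hs', St.nbrs_push]
    by_cases hcs : c = s.size
    · subst hcs; simp [hane.symm]
    · have hc' : c < s.size := by omega
      by_cases hca' : c = a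
      · subst hca'
        simp only [hc', if_true, if_false, hcs, List.append_nil]
        refine List.nodup_append.2 ⟨h.nodup c hc', List.nodup_singleton _, ?_⟩
        intro x hx y hy
        rw [List.mem_singleton] at hy; subst hy
        rintro rfl; exact absurd (h.nbrE c hc' _ hx).1 (lt_irrefl _)
      · simp only [hc', if_true, hca', hcs, if_false, List.append_nil]; exact h.nodup c hc'

end RealizedBy

/-- The root state is realized (with `emb ≡ i`). [folklore] -/
def realizedByRoot (A : Dev) : RealizedBy A St.root (fun _ => A.i) where
  size_pos := by decide
  cur_le := by decide
  emb_zero := rfl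
  inj := by intro a b ha hb _; simp [St.root_size] at ha hb; omega
  posE := by
    intro a ha; simp [St.root_size] at ha; subst ha
    rw [A.pos_i]; exact (toE3_zero).symm
  lvlE := by
    intro a ha; simp [St.root_size] at ha; subst ha
    exact ⟨SimpleGraph.Walk.nil, by simp⟩
  lvl5 := by intro a ha; simp [St.root_size] at ha; subst ha; decide
  lvl4 := by intro a ha; simp [St.root] at ha
  nbrE := by intro a ha b hb; simp [St.root_size] at ha; subst ha; simp [St.nbrs, St.site, St.root] at hb
  doneE := by intro a ha; simp [St.root] at ha
  symm := by intro a ha b hb; simp [St.root_size] at ha; subst ha; simp [St.nbrs, St.site, St.root] at hb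
  nodup := by intro a ha; simp [St.root_size] at ha; subst ha; simp [St.nbrs, St.site, St.root]

end OneStacking

end Summit.AtomisticToContinuum.Crystallization.Theorems
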